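import Summits.MatrixMultiplication.OmegaCensus.Dicyclic16ShapeD
import Summits.MatrixMultiplication.OmegaCensus.Dicyclic16ShapeF
import Summits.MatrixMultiplication.OmegaCensus.C2Quaternion16Law
import Summits.MatrixMultiplication.OmegaCensus.C2C2QuaternionLaw
import HarnessLib

/-!
# Dicyclic type, `|A| = 16`, `A/⟨c₀⟩` non-cyclic: `V ≤ 32`; the groups `C₂ × (ℤ₄ ⋊ ℤ₄)`, `C₂² × Q₈`

ω-census, family (b3).  Framing: lottery ticket; floor = certified bounds/negative ranges.

Abstract form of `β(C₂ × Q₁₆) = 32` (`C2Quaternion16Law.lean`): in dicyclic type `G(A, c₀)`, `c₀ ≠ 0`, `|A| = 16`,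
`A/⟨c₀⟩` not cyclic, every TPP triple has `|S||T||U| ≤ 32`, PROVIDED a projection `π : A → Q` with fibres `{x, x + c₀}`
onto a group `Q` of order `8` without the exact tiling `Q = {0,d,e,d+e} ⊔ {a, a+e} ⊔ {b, b+d}` is supplied
(`Q = ℤ₂ × ℤ₄`: `z2z4_no_exact_tiling`; `Q = ℤ₂³`: `z2z2z2_no_exact_tiling`).  Instances (order 32):
**`β(C₂ × (ℤ₄ ⋊ ℤ₄)) = 32`** (`A = ℤ₂ × ℤ₂ × ℤ₄`, `c₀ = (0,1,0)`, `Q = ℤ₂ × ℤ₄`) — so `c2_semidirect_law_ge_four`: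
`β(C₂ × (ℤ_n ⋊ ℤ₄)) = 16⌊2n/3⌋` for EVERY even `n ≥ 4` — and **`β(C₂² × Q₈) = 32`** (`c₀ = (0,0,2)`, `Q = ℤ₂³`).
-/

namespace Summit.MatrixMultiplication.OmegaCensus

open Literature.Combinatorics.Additive Finset

section Law

variable {A : Type*} [AddCommGroup A] [DecidableEq A] [Fintype A] {G : Type} [Group G] [DecidableEq G]
  {ρ τ : A → G} {c₀ : A} {S T U : Finset G} {Q : Type*} [AddCommGroup Q] [DecidableEq Q]

/-- **Volume `36` is impossible in dicyclic type with `|A| = 16` and `A/⟨c₀⟩` non-cyclic**, given a projection `π`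
with fibres `{x, x + c₀}` onto a group `Q` without the exact 3-piece tiling: the four shape types of
`shape36_of_vertex_bounds` are excluded by saturation, the P3 theorem, `no_36_shape_d_abs`, `no_36_shape_f_abs`. [folklore] -/
theorem no_36_dicyclic_16
    (hρρ : ∀ a b, ρ a * ρ b = ρ (a + b)) (hρτ : ∀ a b, ρ a * τ b = τ (b - a))
    (hτρ : ∀ a b, τ a * ρ b = τ (a + b))
    (hττ : ∀ a b, τ a * τ b = ρ (c₀ + b - a)) (hc₀ : c₀ ≠ 0)
    (hρ : Function.Injective ρ) (hτ : Function.Injective τ) (hne : ∀ a b, ρ a ≠ τ b)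
    (hsurj : ∀ g, (∃ a, ρ a = g) ∨ (∃ a, τ a = g))
    (hnq : ¬ ∃ g : A, ∀ x, x ∈ AddSubgroup.zmultiples g ∨ x + c₀ ∈ AddSubgroup.zmultiples g)
    (hA : Fintype.card A = 16) (h : TripleProductProperty S T U) (hV : S.card * T.card * U.card = 36)
    (π : A →+ Q) (hπ : ∀ X Y : A, π X = π Y ↔ (Y = X ∨ Y = X + c₀))
    (hQ : ∀ d e a b : Q, d ≠ 0 → e ≠ 0 → d ≠ e → d + e ≠ 0 →
      a ∉ ({0, d, e, d + e} : Finset Q) → a + e ∉ ({0, d, e, d + e} : Finset Q) →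
      b ∉ ({0, d, e, d + e} : Finset Q) → b + d ∉ ({0, d, e, d + e} : Finset Q) →
      a ≠ b → a ≠ b + d → a + e ≠ b → a + e ≠ b + d → False) : False := by
  have er : (Equiv.mulRight (1 : G)).toEmbedding = Function.Embedding.refl G := by ext x; simp
  obtain ⟨h000, h111, h100, h011, h010, h101, h001, h110⟩ := vertex_counting' hρρ hρτ hτρ hττ hρ hτ hne h
  rw [hA] at h000 h111 h100 h011 h010 h101 h001 h110
  have cS := card_eq_parts' hρ hτ hne hsurj S
  have cT := card_eq_parts' hρ hτ hne hsurj T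
  have cU := card_eq_parts' hρ hτ hne hsurj U
  set s₀ := (univ.filter fun a : A => ρ a ∈ S).card with hs₀
  set s₁ := (univ.filter fun a : A => τ a ∈ S).card with hs₁
  set t₀ := (univ.filter fun a : A => ρ a ∈ T).card with ht₀
  set t₁ := (univ.filter fun a : A => τ a ∈ T).card with ht₁
  set u₀ := (univ.filter fun a : A => ρ a ∈ U).card with hu₀
  set u₁ := (univ.filter fun a : A => τ a ∈ U).card with hu₁
  have hV' : (s₀ + s₁) * (t₀ + t₁) * (u₀ + u₁) = 36 := by rw [← cS, ← cT, ← cU]; exact hV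
  obtain ⟨-, hsh⟩ := shape36_of_vertex_bounds s₀ s₁ t₀ t₁ u₀ u₁ h000 h111 h100 h011 h010 h101 h001 h110
    (by omega) (by omega)
  -- the volume identities
  have h20 : 3 * (S.card * T.card * U.card) + 20 = 8 * Fintype.card (A) := by rw [hV, hA]
  have h20_SUT : 3 * (S.card * U.card * T.card) + 20 = 8 * Fintype.card (A) := by
    rw [show S.card * U.card * T.card = S.card * T.card * U.card by ring]; exact h20
  have h20_TSU : 3 * (T.card * S.card * U.card) + 20 = 8 * Fintype.card (A) := by
    rw [show T.card * S.card * U.card = S.card * T.card * U.card by ring]; exact h20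
  have h20_TUS : 3 * (T.card * U.card * S.card) + 20 = 8 * Fintype.card (A) := by
    rw [show T.card * U.card * S.card = S.card * T.card * U.card by ring]; exact h20
  have h20_UST : 3 * (U.card * S.card * T.card) + 20 = 8 * Fintype.card (A) := by
    rw [show U.card * S.card * T.card = S.card * T.card * U.card by ring]; exact h20
  have h20_UTS : 3 * (U.card * T.card * S.card) + 20 = 8 * Fintype.card (A) := by
    rw [show U.card * T.card * S.card = S.card * T.card * U.card by ring]; exact h20
  have hmod : Fintype.card (A) % 3 = 1 := by rw [hA]
  have hA14 : 14 ≤ Fintype.card (A) := by rw [hA]; norm_num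
  have three : ∀ {d e : ℕ}, d * e = 3 → (d = 1 ∧ e = 3) ∨ (d = 3 ∧ e = 1) := by
    intro d e hde
    have hd : d ∣ 3 := ⟨e, hde.symm⟩
    have hd3 : d ≤ 3 := Nat.le_of_dvd (by norm_num) hd
    interval_cases d <;> omega
  have two12 : ∀ {d e : ℕ}, d + e = 3 → d * e = 2 → (d = 1 ∧ e = 2) ∨ (d = 2 ∧ e = 1) := by
    intro d e h1 h2
    have hd3 : d ≤ 3 := by omega
    interval_cases d <;> omega
  have two24 : ∀ {d e : ℕ}, d + e = 6 → d * e = 8 → (d = 2 ∧ e = 4) ∨ (d = 4 ∧ e = 2) := by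
    intro d e h1 h2
    have hd6 : d ≤ 6 := by omega
    interval_cases d <;> omega
  -- shape d, all orientations, for an arbitrary TPP triple `(X, Y, Z)` in the given roles
  have orientedD : ∀ {X Y Z : Finset G}, TripleProductProperty X Y Z →
      (univ.filter fun a : A => ρ a ∈ X).card = 1 →
      (univ.filter fun a : A => τ a ∈ X).card = 1 →
      (univ.filter fun a : A => ρ a ∈ Y).card + (univ.filter fun a : A => τ a ∈ Y).card = 3 →
      (univ.filter fun a : A => ρ a ∈ Y).card * (univ.filter fun a : A => τ a ∈ Y).card = 2 →
      (univ.filter fun a : A => ρ a ∈ Z).card + (univ.filter fun a : A => τ a ∈ Z).card = 6 →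
      (univ.filter fun a : A => ρ a ∈ Z).card * (univ.filter fun a : A => τ a ∈ Z).card = 8 →
      False := by
    intro X Y Z hX hx₀ hx₁ hy hy' hz hz'
    have cρY := card_rho_part_mulRight_tau hρρ hρτ hττ (A := A) Y
    have cτY := card_tau_part_mulRight_tau hρρ hττ (A := A) Y
    have cρZ := card_rho_part_mulRight_tau hρρ hρτ hττ (A := A) Z
    have cτZ := card_tau_part_mulRight_tau hρρ hττ (A := A) Z
    rcases two12 hy hy' with ⟨hy₀, hy₁⟩ | ⟨hy₀, hy₁⟩ <;> rcases two24 hz hz' with ⟨hz₀, hz₁⟩ | ⟨hz₀, hz₁⟩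
    · exact no_36_shape_d_abs hρρ hρτ hτρ hττ hρ hτ hne hc₀ hA hX hx₀ hx₁ hy₀ hy₁ hz₀ hz₁ π hπ hQ
    · have h' := hX.map_mulRight 1 1 (τ 0)
      simp only [er, Finset.map_refl] at h'
      exact no_36_shape_d_abs hρρ hρτ hτρ hττ hρ hτ hne hc₀ hA h' hx₀ hx₁ hy₀ hy₁ (by rw [cρZ, hz₁]) (by rw [cτZ, hz₀])
        π hπ hQ
    · have h' := hX.map_mulRight 1 (τ 0) 1
      simp only [er, Finset.map_refl] at h'
      exact no_36_shape_d_abs hρρ hρτ hτρ hττ hρ hτ hne hc₀ hA h' hx₀ hx₁ (by rw [cρY, hy₁]) (by rw [cτY, hy₀]) hz₀ hz₁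
        π hπ hQ
    · have h' := hX.map_mulRight 1 (τ 0) (τ 0)
      simp only [er, Finset.map_refl] at h'
      exact no_36_shape_d_abs hρρ hρτ hτρ hττ hρ hτ hne hc₀ hA h' hx₀ hx₁ (by rw [cρY, hy₁]) (by rw [cτY, hy₀])
        (by rw [cρZ, hz₁]) (by rw [cτZ, hz₀]) π hπ hQ
  -- shape f, all orientations
  have orientedF : ∀ {X Y Z : Finset G}, TripleProductProperty X Y Z →
      (univ.filter fun a : A => ρ a ∈ X).card + (univ.filter fun a : A => τ a ∈ X).card = 3 →
      (univ.filter fun a : A => ρ a ∈ X).card * (univ.filter fun a : A => τ a ∈ X).card = 2 →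
      (univ.filter fun a : A => ρ a ∈ Y).card + (univ.filter fun a : A => τ a ∈ Y).card = 3 →
      (univ.filter fun a : A => ρ a ∈ Y).card * (univ.filter fun a : A => τ a ∈ Y).card = 2 →
      (univ.filter fun a : A => ρ a ∈ Z).card = 2 →
      (univ.filter fun a : A => τ a ∈ Z).card = 2 → False := by
    intro X Y Z hX hx hx' hy hy' hz₀ hz₁
    have cρX := card_rho_part_mulRight_tau hρρ hρτ hττ (A := A) X
    have cτX := card_tau_part_mulRight_tau hρρ hττ (A := A) X
    have cρY := card_rho_part_mulRight_tau hρρ hρτ hττ (A := A) Y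
    have cτY := card_tau_part_mulRight_tau hρρ hττ (A := A) Y
    rcases two12 hx hx' with ⟨hx₀, hx₁⟩ | ⟨hx₀, hx₁⟩ <;> rcases two12 hy hy' with ⟨hy₀, hy₁⟩ | ⟨hy₀, hy₁⟩
    · exact no_36_shape_f_abs hρρ hρτ hτρ hττ hρ hτ hne hc₀ hA hX hx₀ hx₁ hy₀ hy₁ hz₀ hz₁ π hπ hQ
    · have h' := hX.map_mulRight 1 (τ 0) 1
      simp only [er, Finset.map_refl] at h'
      exact no_36_shape_f_abs hρρ hρτ hτρ hττ hρ hτ hne hc₀ hA h' hx₀ hx₁ (by rw [cρY, hy₁]) (by rw [cτY, hy₀]) hz₀ hz₁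
        π hπ hQ
    · have h' := hX.map_mulRight (τ 0) 1 1
      simp only [er, Finset.map_refl] at h'
      exact no_36_shape_f_abs hρρ hρτ hτρ hττ hρ hτ hne hc₀ hA h' (by rw [cρX, hx₁]) (by rw [cτX, hx₀]) hy₀ hy₁ hz₀ hz₁
        π hπ hQ
    · have h' := hX.map_mulRight (τ 0) (τ 0) 1
      simp only [er, Finset.map_refl] at h'
      exact no_36_shape_f_abs hρρ hρτ hτρ hττ hρ hτ hne hc₀ hA h'
        (by rw [cρX, hx₁]) (by rw [cτX, hx₀]) (by rw [cρY, hy₁])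
        (by rw [cτY, hy₀]) hz₀ hz₁ π hπ hQ
  rcases hsh with ⟨a, b, c, d⟩ | ⟨a, b, c, d⟩ | ⟨a, b, c, d⟩ | ⟨et, eu, hp, hδ⟩ | ⟨es, eu, hp, hδ⟩ | ⟨es, et, hp, hδ⟩ |
    ⟨a, b, c, d, e, f⟩ | ⟨a, b, c, d, e, f⟩ | ⟨a, b, c, d, e, f⟩ | ⟨a, b, c, d, e, f⟩ | ⟨a, b, c, d, e, f⟩ |
    ⟨a, b, c, d, e, f⟩ | ⟨a, b, c, d, e, f⟩ | ⟨a, b, c, d, e, f⟩ | ⟨a, b, c, d, e, f⟩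
  -- two dominoes
  · exact hnq (quot_cyclic_of_two_two_sub_four hρρ hρτ hτρ hττ hc₀ hρ hτ hne hsurj hmod hA14 h a b c d h20)
  · exact hnq (quot_cyclic_of_two_two_sub_four hρρ hρτ hτρ hττ hc₀ hρ hτ hne hsurj hmod hA14 (tpp_reverse h.rotate)
      a b c d h20_SUT)
  · exact hnq (quot_cyclic_of_two_two_sub_four hρρ hρτ hτρ hττ hc₀ hρ hτ hne hsurj hmod hA14 h.rotate a b c d h20_TUS)
  -- P3
  · rcases three hp with ⟨hd, he⟩ | ⟨hd, he⟩
    · exact no_sub_four_P3_of_c0_ne_zero hρρ hρτ hτρ hττ hc₀ hρ hτ hne hsurj h hδ hd (by omega) he (by omega) h20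
    · exact no_sub_four_P3_of_c0_ne_zero hρρ hρτ hτρ hττ hc₀ hρ hτ hne hsurj (tpp_reverse h.rotate) hδ he
        (by omega) hd (by omega) h20_SUT
  · rcases three hp with ⟨hd, he⟩ | ⟨hd, he⟩
    · exact no_sub_four_P3_of_c0_ne_zero hρρ hρτ hτρ hττ hc₀ hρ hτ hne hsurj (tpp_reverse h.rotate.rotate) hδ hd
        (by omega) he (by omega) h20_TSU
    · exact no_sub_four_P3_of_c0_ne_zero hρρ hρτ hτρ hττ hc₀ hρ hτ hne hsurj h.rotate hδ he (by omega) hd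
        (by omega) h20_TUS
  · rcases three hp with ⟨hd, he⟩ | ⟨hd, he⟩
    · exact no_sub_four_P3_of_c0_ne_zero hρρ hρτ hτρ hττ hc₀ hρ hτ hne hsurj h.rotate.rotate hδ hd (by omega) he
        (by omega) h20_UST
    · exact no_sub_four_P3_of_c0_ne_zero hρρ hρτ hτρ hττ hc₀ hρ hτ hne hsurj (tpp_reverse h) hδ he (by omega) hd
        (by omega) h20_UTS
  -- shape d in the six role assignments
  · exact orientedD h a b c d e f
  · exact orientedD (tpp_reverse h.rotate) a b c d e f
  · exact orientedD (tpp_reverse h.rotate.rotate) a b c d e f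
  · exact orientedD h.rotate a b c d e f
  · exact orientedD h.rotate.rotate a b c d e f
  · exact orientedD (tpp_reverse h) a b c d e f
  -- shape f in the three role assignments
  · exact orientedF h c d e f a b
  · exact orientedF (tpp_reverse h.rotate) c d e f a b
  · exact orientedF h.rotate c d e f a b

end Law

section Le16

variable {A : Type*} [AddCommGroup A] [DecidableEq A] [Fintype A] {G : Type} [Group G] [DecidableEq G]
  {ρ τ : A → G} {c₀ : A} {S T U : Finset G} {Q : Type*} [AddCommGroup Q] [DecidableEq Q]

/-- **Dicyclic type, `|A| = 16`, `A/⟨c₀⟩` not cyclic (with a projection `π` as above) ⇒ `|S||T||U| ≤ 32`.** [folklore] -/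
theorem tpp_volume_dicyclic_16_le
    (hρρ : ∀ a b, ρ a * ρ b = ρ (a + b)) (hρτ : ∀ a b, ρ a * τ b = τ (b - a))
    (hτρ : ∀ a b, τ a * ρ b = τ (a + b)) (hττ : ∀ a b, τ a * τ b = ρ (c₀ + b - a)) (hc₀ : c₀ ≠ 0)
    (hnq : ¬ ∃ g : A, ∀ x : A, x ∈ AddSubgroup.zmultiples g ∨ x + c₀ ∈ AddSubgroup.zmultiples g)
    (hρ : Function.Injective ρ) (hτ : Function.Injective τ) (hne : ∀ a b, ρ a ≠ τ b)
    (hsurj : ∀ g, (∃ a, ρ a = g) ∨ (∃ a, τ a = g)) (hA : Fintype.card A = 16) (h : TripleProductProperty S T U)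
    (π : A →+ Q) (hπ : ∀ X Y : A, π X = π Y ↔ (Y = X ∨ Y = X + c₀))
    (hQ : ∀ d e a b : Q, d ≠ 0 → e ≠ 0 → d ≠ e → d + e ≠ 0 →
      a ∉ ({0, d, e, d + e} : Finset Q) → a + e ∉ ({0, d, e, d + e} : Finset Q) →
      b ∉ ({0, d, e, d + e} : Finset Q) → b + d ∉ ({0, d, e, d + e} : Finset Q) →
      a ≠ b → a ≠ b + d → a + e ≠ b → a + e ≠ b + d → False) :
    S.card * T.card * U.card ≤ 32 := by
  have hmod : Fintype.card A % 3 = 1 := by rw [hA]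
  have hA14 : 14 ≤ Fintype.card A := by rw [hA]; norm_num
  rcases tpp_volume_mod_one_gap hρρ hρτ hτρ hττ hρ hτ hne hsurj hmod hA14 h with hlaw | hgap
  · exact (hnq (quot_cyclic_of_mod_one_law_of_c0_ne_zero hρρ hρτ hτρ hττ hc₀ hρ hτ hne hsurj hmod hA14 h hlaw)).elim
  rw [hA] at hgap
  by_contra hgt
  push Not at hgt
  obtain ⟨h000, h111, h100, h011, h010, h101, h001, h110⟩ := vertex_counting' hρρ hρτ hτρ hττ hρ hτ hne h
  rw [hA] at h000 h111 h100 h011 h010 h101 h001 h110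
  have cS := card_eq_parts' hρ hτ hne hsurj S
  have cT := card_eq_parts' hρ hτ hne hsurj T
  have cU := card_eq_parts' hρ hτ hne hsurj U
  have hV36 : S.card * T.card * U.card = 36 := by
    rw [cS, cT, cU] at hgt hgap ⊢
    exact (shape36_of_vertex_bounds _ _ _ _ _ _ h000 h111 h100 h011 h010 h101 h001 h110 (by omega) (by omega)).1
  exact no_36_dicyclic_16 hρρ hρτ hτρ hττ hc₀ hρ hτ hne hsurj hnq hA h hV36 π hπ hQ

end Le16

section Order32

set_option synthInstance.maxHeartbeats 400000 in
set_option synthInstance.maxSize 4096 in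
/-- `ℤ₂³` has no exact tiling `{0,d,e,d+e} ⊔ {a,a+e} ⊔ {b,b+d}`. [folklore] -/
theorem z2z2z2_no_exact_tiling :
    ∀ d e a b : ZMod 2 × (ZMod 2 × ZMod 2), d ≠ 0 → e ≠ 0 → d ≠ e → d + e ≠ 0 →
      a ∉ ({0, d, e, d + e} : Finset (ZMod 2 × (ZMod 2 × ZMod 2))) →
      a + e ∉ ({0, d, e, d + e} : Finset (ZMod 2 × (ZMod 2 × ZMod 2))) →
      b ∉ ({0, d, e, d + e} : Finset (ZMod 2 × (ZMod 2 × ZMod 2))) →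
      b + d ∉ ({0, d, e, d + e} : Finset (ZMod 2 × (ZMod 2 × ZMod 2))) →
      a ≠ b → a ≠ b + d → a + e ≠ b → a + e ≠ b + d → False := by
  decide

/-- The projection `ℤ₂ × ℤ₂ × ℤ₄ → ℤ₂ × ℤ₄`, `(x,y,z) ↦ (x,z)`, identifies exactly `X` and `X + (0,1,0)`. [folklore] -/
theorem proj_z2z2z4_eq_iff : ∀ X Y : ZMod 2 × (ZMod 2 × ZMod 4),
    ((AddMonoidHom.fst (ZMod 2) (ZMod 2 × ZMod 4)).prod
        ((AddMonoidHom.snd (ZMod 2) (ZMod 4)).comp (AddMonoidHom.snd (ZMod 2) (ZMod 2 × ZMod 4)))) X =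
      ((AddMonoidHom.fst (ZMod 2) (ZMod 2 × ZMod 4)).prod
        ((AddMonoidHom.snd (ZMod 2) (ZMod 4)).comp (AddMonoidHom.snd (ZMod 2) (ZMod 2 × ZMod 4)))) Y ↔
      (Y = X ∨ Y = X + ((0 : ZMod 2), (((1 : ZMod 2), (0 : ZMod 4))))) := by
  decide

/-- The projection `ℤ₂ × ℤ₂ × ℤ₄ → ℤ₂³`, `(x,y,z) ↦ (x,y,z mod 2)`, identifies exactly `X` and `X + (0,0,2)`. [folklore] -/
theorem proj_z2z2z4_mod_two_eq_iff : ∀ X Y : ZMod 2 × (ZMod 2 × ZMod (2 * 2)),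
    ((AddMonoidHom.id (ZMod 2)).prodMap ((AddMonoidHom.id (ZMod 2)).prodMap
        (ZMod.castHom (show 2 ∣ 2 * 2 by norm_num) (ZMod 2)).toAddMonoidHom)) X =
      ((AddMonoidHom.id (ZMod 2)).prodMap ((AddMonoidHom.id (ZMod 2)).prodMap
        (ZMod.castHom (show 2 ∣ 2 * 2 by norm_num) (ZMod 2)).toAddMonoidHom)) Y ↔
      (Y = X ∨ Y = X + ((0 : ZMod 2), (((0 : ZMod 2), ((2 : ℕ) : ZMod (2 * 2)))))) := by
  decide

/-- **`β(C₂ × (ℤ₄ ⋊ ℤ₄)) = 32`** (order `32`; kernel). [folklore] -/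
theorem c2_semidirect_4_law :
    (∀ S T U : Finset (Multiplicative (ZMod 2) × DihedralLikeGroup (ZMod 2 × ZMod 4) ((1 : ZMod 2), 0)),
        TripleProductProperty S T U → S.card * T.card * U.card ≤ 32) ∧
    ∃ S T U : Finset (Multiplicative (ZMod 2) × DihedralLikeGroup (ZMod 2 × ZMod 4) ((1 : ZMod 2), 0)),
      TripleProductProperty S T U ∧ S.card * T.card * U.card = 32 := by
  refine ⟨fun S T U h => ?_, ?_⟩
  · obtain ⟨hc₀, hnq⟩ := z2_z2_zn_quot_noncyclic (n := 4) ⟨2, rfl⟩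
    refine c2_semidirect_presentation (n := 4) fun ρ τ c₀ hρρ hρτ hτρ hττ hρ hτ hne hsurj hc => ?_
    subst hc
    exact tpp_volume_dicyclic_16_le hρρ hρτ hτρ hττ hc₀ hnq hρ hτ hne hsurj
      (by rw [Fintype.card_prod, Fintype.card_prod, ZMod.card, ZMod.card]) h _ proj_z2z2z4_eq_iff
      z2z4_no_exact_tiling
  · obtain ⟨S, T, U, h, hV⟩ := c2_semidirect_volume_ge (n := 4) (by norm_num)
    exact ⟨S, T, U, h, by rw [hV]⟩

/-- **`β(C₂ × (ℤ_n ⋊ ℤ₄)) = 16⌊2n/3⌋` for every even `n ≥ 4`** (kernel). [folklore] -/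
theorem c2_semidirect_law_ge_four {n : ℕ} [NeZero n] (hn2 : 2 ∣ n) (hn : 4 ≤ n) :
    (∀ S T U : Finset (Multiplicative (ZMod 2) × DihedralLikeGroup (ZMod 2 × ZMod n) ((1 : ZMod 2), 0)),
        TripleProductProperty S T U → S.card * T.card * U.card ≤ 16 * (2 * n / 3)) ∧
    ∃ S T U : Finset (Multiplicative (ZMod 2) × DihedralLikeGroup (ZMod 2 × ZMod n) ((1 : ZMod 2), 0)),
      TripleProductProperty S T U ∧ S.card * T.card * U.card = 16 * (2 * n / 3) := by
  by_cases h6 : 6 ≤ n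
  · exact c2_semidirect_law_ge_six hn2 h6
  obtain rfl : n = 4 := by omega
  exact c2_semidirect_4_law

/-- **`β(C₂² × Q₈) = 32 = |G|`** (order `32`; kernel). [folklore] -/
theorem c2c2_quaternion_8_law :
    (∀ S T U : Finset (Multiplicative (ZMod 2) × (Multiplicative (ZMod 2) × QuaternionGroup 2)),
        TripleProductProperty S T U → S.card * T.card * U.card ≤ 32) ∧
    ∃ S T U : Finset (Multiplicative (ZMod 2) × (Multiplicative (ZMod 2) × QuaternionGroup 2)),
      TripleProductProperty S T U ∧ S.card * T.card * U.card = 32 := by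
  refine ⟨fun S T U h => ?_, ⟨univ, {1}, {1}, tpp_univ_one_one, ?_⟩⟩
  · obtain ⟨hc₀', hnq⟩ := z2_z2_z2m_quot_noncyclic (m := 2)
    refine c2_quaternion_presentation (m := 2) fun ρ τ c₀ hρρ hρτ hτρ hττ hρ hτ hne hsurj hc => ?_
    subst hc
    refine c2_product_presentation hρρ hρτ hτρ hττ hρ hτ hne hsurj
      fun ρ' τ' c₀' hρρ' hρτ' hτρ' hττ' hρ' hτ' hne' hsurj' hc' => ?_
    subst hc'
    exact tpp_volume_dicyclic_16_le hρρ' hρτ' hτρ' hττ' hc₀' hnq hρ' hτ' hne' hsurj'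
      (by rw [Fintype.card_prod, Fintype.card_prod, ZMod.card, ZMod.card]) h _ proj_z2z2z4_mod_two_eq_iff
      z2z2z2_no_exact_tiling
  · rw [card_univ, card_singleton, Fintype.card_prod, Fintype.card_prod, Fintype.card_multiplicative, ZMod.card]
    simp [QuaternionGroup.card]

/-- **`β(C₂² × Q_{4m}) = 2β(C₂ × Q_{4m})` for every `m ≥ 2`, `m ≢ 4 (mod 6)`** (`c2c2_quaternion_law` plus the order-32
case `m = 2`). [folklore] -/
theorem c2c2_quaternion_law_ge_two {m : ℕ} [NeZero m] (hm : 2 ≤ m) (h4 : m % 6 ≠ 4) :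
    (∀ S T U : Finset (Multiplicative (ZMod 2) × (Multiplicative (ZMod 2) × QuaternionGroup m)),
        TripleProductProperty S T U →
        S.card * T.card * U.card ≤ if m % 6 = 1 then (64 * m - 16) / 3 else 32 * (2 * m / 3)) ∧
    ∃ S T U : Finset (Multiplicative (ZMod 2) × (Multiplicative (ZMod 2) × QuaternionGroup m)),
      TripleProductProperty S T U ∧
      S.card * T.card * U.card = if m % 6 = 1 then (64 * m - 16) / 3 else 32 * (2 * m / 3) := by
  by_cases h3 : 3 ≤ m
  · exact c2c2_quaternion_law h3 h4
  obtain rfl : m = 2 := by omega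
  simp only [show ¬ (2 % 6 = 1) by decide, if_false]
  obtain ⟨hub, S, T, U, h, hV⟩ := c2c2_quaternion_8_law
  exact ⟨fun S' T' U' h' => by have := hub S' T' U' h'; omega, S, T, U, h, by omega⟩

/-- The projection `ℤ₄ × ℤ₄ → ℤ₂ × ℤ₄`, `(x,y) ↦ (x mod 2, y)`, identifies exactly `X` and `X + (2,0)`. [folklore] -/
theorem proj_z4z4_eq_iff : ∀ X Y : ZMod 4 × ZMod 4,
    ((ZMod.castHom (show 2 ∣ 4 by norm_num) (ZMod 2)).toAddMonoidHom.prodMap (AddMonoidHom.id (ZMod 4))) X =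
      ((ZMod.castHom (show 2 ∣ 4 by norm_num) (ZMod 2)).toAddMonoidHom.prodMap (AddMonoidHom.id (ZMod 4))) Y ↔
      (Y = X ∨ Y = X + ((2 : ZMod 4), (0 : ZMod 4))) := by
  decide

/-- `(ℤ₄ × ℤ₄)/⟨(2,0)⟩ ≅ ℤ₂ × ℤ₄` is not cyclic. [folklore] -/
theorem z4z4_quot_noncyclic :
    ¬ ∃ g : ZMod 4 × ZMod 4, ∀ x, x ∈ AddSubgroup.zmultiples g ∨
      x + ((2 : ZMod 4), (0 : ZMod 4)) ∈ AddSubgroup.zmultiples g := by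
  rintro ⟨g, hg⟩
  set φ : ZMod 4 × ZMod 4 →+ ZMod 2 × ZMod 4 :=
    (ZMod.castHom (show 2 ∣ 4 by norm_num) (ZMod 2)).toAddMonoidHom.prodMap (AddMonoidHom.id (ZMod 4)) with hφ
  have hφc : φ ((2 : ZMod 4), (0 : ZMod 4)) = 0 := by decide
  have hsurj : ∀ y : ZMod 2 × ZMod 4, ∃ x : ZMod 4 × ZMod 4, φ x = y := by decide
  apply not_cyclic_zmod_two_prod (k := 4) ⟨2, rfl⟩
  refine ⟨φ g, fun y => ?_⟩
  obtain ⟨x, rfl⟩ := hsurj y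
  have key : ∀ z : ZMod 4 × ZMod 4, z ∈ AddSubgroup.zmultiples g → φ z ∈ AddSubgroup.zmultiples (φ g) := by
    intro z hz
    obtain ⟨k, hk⟩ := AddSubgroup.mem_zmultiples_iff.1 hz
    exact AddSubgroup.mem_zmultiples_iff.2 ⟨k, by rw [← hk, map_zsmul]⟩
  rcases hg x with hx | hx
  · exact key x hx
  · have := key _ hx
    rwa [map_add, hφc, add_zero] at this

/-- **`β(G(ℤ₄², (2,0))) = 32 = |G|`** for the dicyclic-type group over `ℤ₄ × ℤ₄` (`= ℤ₄ ⋊ Q₈`, order `32`; kernel; the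
`Fact` instance making the model a group is taken as a hypothesis). [folklore] -/
theorem dicyclicType_z4z4_law {c₀ : ZMod 4 × ZMod 4} [Fact (c₀ + c₀ = 0)] (hc : c₀ = ((2 : ZMod 4), (0 : ZMod 4))) :
    (∀ S T U : Finset (DihedralLikeGroup (ZMod 4 × ZMod 4) c₀), TripleProductProperty S T U →
        S.card * T.card * U.card ≤ 32) ∧
    ∃ S T U : Finset (DihedralLikeGroup (ZMod 4 × ZMod 4) c₀), TripleProductProperty S T U ∧
      S.card * T.card * U.card = 32 := by
  refine ⟨fun S T U h => ?_, ⟨univ, {1}, {1}, tpp_univ_one_one, ?_⟩⟩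
  · have hnq := z4z4_quot_noncyclic
    have hc₀ : c₀ ≠ 0 := by rw [hc]; decide
    rw [← hc] at hnq
    refine tpp_volume_dicyclic_16_le (ρ := (DihedralLikeGroup.rho : ZMod 4 × ZMod 4 → DihedralLikeGroup _ c₀))
      (τ := DihedralLikeGroup.tau) DihedralLikeGroup.rho_mul_rho DihedralLikeGroup.rho_mul_tau
      DihedralLikeGroup.tau_mul_rho DihedralLikeGroup.tau_mul_tau hc₀ hnq DihedralLikeGroup.rho_injective
      DihedralLikeGroup.tau_injective DihedralLikeGroup.rho_ne_tau DihedralLikeGroup.rho_or_tau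
      (by rw [Fintype.card_prod, ZMod.card]) h
      ((ZMod.castHom (show 2 ∣ 4 by norm_num) (ZMod 2)).toAddMonoidHom.prodMap (AddMonoidHom.id (ZMod 4))) ?_
      z2z4_no_exact_tiling
    subst hc
    exact proj_z4z4_eq_iff
  · rw [card_univ, card_singleton, DihedralLikeGroup.card, Fintype.card_prod, ZMod.card]

end Order32

end Summit.MatrixMultiplication.OmegaCensus
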